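import Summits.Parity.BatemanHorn.Theses.IsogenyRedei
import Summits.Parity.BatemanHorn.Theorems.IsogenyRedeiOmegaToMobiusAPCounting
import Summits.Parity.BatemanHorn.Theorems.IsogenyRedeiOmegaToMobiusAPSieve

/-!
# Route `IsogenyRedei` — support item `OmegaToMobiusAP` (stmt-Parity-11588)

`QuadraticOmegaParity → (∀ f irreducible quadratic with positive leading coefficient, ∀ q ≥ 1, a:
Σ_{n ≤ x, n ≡ a (q)} μ(f(n)) = o(x))`, where `QuadraticOmegaParity` is the same statement with
`(−1)^{ω(f(n))}` in place of `μ(f(n))` (values `f(n) ≤ 0`, finitely many, enter through `toNat`).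

Proof (squarefree sieve with a FIXED level `R`, then `R → ∞`; no uniformity in the modulus is
needed, as the refuters' notes on the item point out).  Write `μ(m) = (−1)^{ω(m)}·1[m squarefree]`.
For `R ≥ 1` put `M = q·(R!)²`; for `n ≥ N₀(f)` (so that `f(n) > 0`) the condition "no prime
`p ≤ R` has `p² ∣ f(n)`" depends only on `n mod M`, so the sum of `(−1)^{ω(f(n))}` over
`n ≤ x, n ≡ a (q)` with that condition is a finite sum, over admissible residues `c mod M`, of the
hypothesis' sums along `n ≡ c (M)` — each `o(x)`.  The remaining error is at most `2N₀` plus the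
number of `n ≤ x` with `p² ∣ f(n)` for some prime `p > R`; such `p` is `≤ B·x` (`f(n) ≤ B x²`),
and for `p ∤ 2A·disc(f)` (all `p > R ≥ R₀(f)`) the roots of `f` modulo `p²` lie in two residue
classes, giving `≤ Σ_{R < p ≤ Bx} 2(x/p² + 1) ≤ 2x/R + 2π(Bx)` with `π(y) = o(y)` (Chebyshev).
Hence `limsup |S(x)|/x ≤ 2/R` for every `R`, i.e. `S(x) = o(x)`.
The counting lemmas are in `IsogenyRedeiOmegaToMobiusAPCounting`, the pointwise sieve lemmas in
`IsogenyRedeiOmegaToMobiusAPSieve`; here the core estimate `core_estimate` and the deciding theorem.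
-/

open Filter Finset Asymptotics Polynomial

namespace Summit.Parity.BatemanHorn.Theorems.OmegaToMobiusAP

/-- **Core estimate** of the squarefree sieve (see the module docstring). [folklore] -/
theorem core_estimate (f : ℤ[X]) (hf : f.natDegree = 2)
    (N₀ : ℕ) (hN₀ : ∀ n : ℕ, N₀ ≤ n → 0 < f.eval (n : ℤ))
    (Bh : ℕ) (hBh1 : 1 ≤ Bh)
    (hBh : ∀ n x : ℕ, 1 ≤ n → n ≤ x → f.eval (n : ℤ) ≤ (Bh : ℤ) * (x : ℤ) ^ 2)
    (R : ℕ) (hR : 0 < R)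
    (hgood : ∀ p : ℕ, p.Prime → R < p →
      ¬ (p : ℤ) ∣ 2 * f.coeff 2 * (f.coeff 1 ^ 2 - 4 * f.coeff 2 * f.coeff 0))
    (q a : ℕ) (hq : 0 < q) (x : ℕ) :
    |∑ n ∈ (Finset.Icc 1 x).filter (fun n : ℕ => n ≡ a [MOD q]),
          (ArithmeticFunction.moebius ((f.eval (n : ℤ)).toNat) : ℝ)
      - ∑ c ∈ (Finset.range (q * Nat.factorial R ^ 2)).filter (fun c : ℕ => c ≡ a [MOD q] ∧
            ∀ p ∈ Finset.range (R + 1), p.Prime → ¬ ((p : ℤ) ^ 2 ∣ f.eval (c : ℤ))),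
          ∑ n ∈ (Finset.Icc 1 x).filter (fun n : ℕ => n ≡ c [MOD q * Nat.factorial R ^ 2]),
            (-1 : ℝ) ^ ArithmeticFunction.cardDistinctFactors ((f.eval (n : ℤ)).toNat)|
      ≤ 2 * N₀ + 2 * x / R + 2 * (Nat.primesLE (Bh * x)).card := by
  classical
  set M := q * Nat.factorial R ^ 2 with hM
  have hMpos : 0 < M := Nat.mul_pos hq (pow_pos (Nat.factorial_pos R) 2)
  have hqM : q ∣ M := Dvd.intro _ rfl
  set A := (Finset.Icc 1 x).filter (fun n : ℕ => n ≡ a [MOD q]) with hA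
  set s : ℕ → ℝ := fun n => (-1 : ℝ) ^ ArithmeticFunction.cardDistinctFactors ((f.eval (n : ℤ)).toNat)
    with hs
  set P : ℕ → Prop := fun c => ∀ p ∈ Finset.range (R + 1), p.Prime → ¬ ((p : ℤ) ^ 2 ∣ f.eval (c : ℤ))
    with hP
  set χ : ℕ → ℝ := fun n => if P (n % M) then 1 else 0 with hχ
  set PR := (Nat.primesLE (Bh * x)).filter (fun p => R < p) with hPR
  -- Step 1: the main term is `Σ_{n ∈ A} s n * χ n`
  have hmain : ∑ c ∈ (Finset.range M).filter (fun c : ℕ => c ≡ a [MOD q] ∧ P c),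
        ∑ n ∈ (Finset.Icc 1 x).filter (fun n : ℕ => n ≡ c [MOD M]), s n
      = ∑ n ∈ A, s n * χ n := by
    rw [← sum_filter_modEq_regroup s P hMpos hqM a x]
    rw [hA, ← Finset.filter_filter, Finset.sum_filter]
    refine Finset.sum_congr rfl (fun n _ => ?_)
    simp only [hχ]
    split_ifs <;> simp
  -- Step 2: pointwise error and its sum
  have herr : ∀ n ∈ A, |s n * χ n - (ArithmeticFunction.moebius ((f.eval (n : ℤ)).toNat) : ℝ)|
      ≤ 2 * (if n < N₀ then (1 : ℝ) else 0)
        + ∑ p ∈ PR, (if (p : ℤ) ^ 2 ∣ f.eval (n : ℤ) then (1 : ℝ) else 0) := by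
    intro n hn
    have hn' : n ∈ Finset.Icc 1 x := (Finset.mem_filter.mp hn).1
    exact abs_pointwise_error_le f N₀ hN₀ Bh hBh1 hBh q R hn'
  have hAsub : A ⊆ Finset.Icc 1 x := Finset.filter_subset _ _
  -- the two pieces of the summed error
  have hpiece1 : ∑ n ∈ Finset.Icc 1 x, (2 * (if n < N₀ then (1 : ℝ) else 0)) ≤ 2 * N₀ := by
    rw [← Finset.mul_sum, ← Finset.sum_filter, Finset.sum_const, nsmul_eq_mul, mul_one]
    have hc : ((Finset.Icc 1 x).filter (fun n => n < N₀)).card ≤ N₀ := by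
      calc ((Finset.Icc 1 x).filter (fun n => n < N₀)).card ≤ (Finset.range N₀).card :=
            Finset.card_le_card (fun n hn => by
              rw [Finset.mem_filter] at hn
              exact Finset.mem_range.mpr hn.2)
        _ = N₀ := Finset.card_range _
    have hc' : (((Finset.Icc 1 x).filter (fun n => n < N₀)).card : ℝ) ≤ N₀ := by exact_mod_cast hc
    linarith
  have hpiece2 : ∑ n ∈ Finset.Icc 1 x, ∑ p ∈ PR, (if (p : ℤ) ^ 2 ∣ f.eval (n : ℤ) then (1 : ℝ) else 0)
      ≤ 2 * x / R + 2 * (Nat.primesLE (Bh * x)).card := by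
    rw [Finset.sum_comm]
    refine le_trans (Finset.sum_le_sum (fun p hp => ?_)) (sum_local_bounds_le R Bh x hR)
    -- one prime
    rw [← Finset.sum_filter, Finset.sum_const, nsmul_eq_mul, mul_one]
    have hpp : p.Prime := (Nat.mem_primesLE.mp (Finset.mem_filter.mp hp).1).2
    have hRp : R < p := (Finset.mem_filter.mp hp).2
    have hcard := card_roots_Icc_le hpp (hgood p hpp hRp) x
    have heq : (Finset.Icc 1 x).filter (fun n : ℕ => (p : ℤ) ^ 2 ∣ f.eval (n : ℤ))
        = (Finset.Icc 1 x).filter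
            (fun n : ℕ => (p : ℤ) ^ 2 ∣ f.coeff 2 * n ^ 2 + f.coeff 1 * n + f.coeff 0) := by
      refine Finset.filter_congr (fun n _ => ?_)
      rw [Literature.NumberTheory.Sieve.eval_eq_of_natDegree_eq_two hf]
    rw [heq]
    exact_mod_cast hcard
  -- Step 3: assemble
  have hdiff : ∑ n ∈ A, (ArithmeticFunction.moebius ((f.eval (n : ℤ)).toNat) : ℝ)
      - ∑ c ∈ (Finset.range M).filter (fun c : ℕ => c ≡ a [MOD q] ∧ P c),
          ∑ n ∈ (Finset.Icc 1 x).filter (fun n : ℕ => n ≡ c [MOD M]), s n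
      = - ∑ n ∈ A, (s n * χ n - (ArithmeticFunction.moebius ((f.eval (n : ℤ)).toNat) : ℝ)) := by
    rw [hmain, Finset.sum_sub_distrib]
    ring
  rw [hdiff, abs_neg]
  calc |∑ n ∈ A, (s n * χ n - (ArithmeticFunction.moebius ((f.eval (n : ℤ)).toNat) : ℝ))|
      ≤ ∑ n ∈ A, |s n * χ n - (ArithmeticFunction.moebius ((f.eval (n : ℤ)).toNat) : ℝ)| :=
        Finset.abs_sum_le_sum_abs _ _
    _ ≤ ∑ n ∈ A, (2 * (if n < N₀ then (1 : ℝ) else 0)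
          + ∑ p ∈ PR, (if (p : ℤ) ^ 2 ∣ f.eval (n : ℤ) then (1 : ℝ) else 0)) :=
        Finset.sum_le_sum herr
    _ ≤ ∑ n ∈ Finset.Icc 1 x, (2 * (if n < N₀ then (1 : ℝ) else 0)
          + ∑ p ∈ PR, (if (p : ℤ) ^ 2 ∣ f.eval (n : ℤ) then (1 : ℝ) else 0)) := by
        refine Finset.sum_le_sum_of_subset_of_nonneg hAsub (fun n _ _ => ?_)
        refine add_nonneg (by split_ifs <;> norm_num) (Finset.sum_nonneg (fun p _ => ?_))
        split_ifs <;> norm_num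
    _ = ∑ n ∈ Finset.Icc 1 x, (2 * (if n < N₀ then (1 : ℝ) else 0))
          + ∑ n ∈ Finset.Icc 1 x,
              ∑ p ∈ PR, (if (p : ℤ) ^ 2 ∣ f.eval (n : ℤ) then (1 : ℝ) else 0) :=
        Finset.sum_add_distrib
    _ ≤ 2 * N₀ + (2 * x / R + 2 * (Nat.primesLE (Bh * x)).card) := add_le_add hpiece1 hpiece2
    _ = 2 * N₀ + 2 * x / R + 2 * (Nat.primesLE (Bh * x)).card := by ring

end Summit.Parity.BatemanHorn.Theorems.OmegaToMobiusAP

namespace Summit.Parity.BatemanHorn.Theorems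

open Summit.Parity.BatemanHorn.Theses.IsogenyRedei
open Summit.Parity.BatemanHorn.Theorems.OmegaToMobiusAP

/-- **`OmegaToMobiusAP`** (stmt-Parity-11588): ω-parity of the values of an irreducible integer
quadratic along every arithmetic progression implies `Σ_{n ≤ x, n ≡ a (q)} μ(f(n)) = o(x)`, by the
squarefree sieve. [folklore] -/
theorem omegaToMobiusAP_proof : OmegaToMobiusAP := by
  intro H f hirr hf hlc q a hq
  -- the constants attached to `f = A X² + B X + C`
  set A := f.coeff 2 with hAdef
  set B := f.coeff 1 with hBdef
  set C := f.coeff 0 with hCdef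
  have hA : 0 < A := by
    have h : f.leadingCoeff = A := by rw [Polynomial.leadingCoeff, hf]
    rw [← h]
    exact hlc
  have hD : B ^ 2 - 4 * A * C ≠ 0 := by
    have h := Literature.NumberTheory.Sieve.discrim_ne_zero_of_irreducible hf hirr
    unfold discrim at h
    exact h
  set N₀ : ℕ := B.natAbs + C.natAbs + 1 with hN₀def
  set Bh : ℕ := A.natAbs + B.natAbs + C.natAbs with hBhdef
  set R₀ : ℕ := (2 * A * (B ^ 2 - 4 * A * C)).natAbs + 1 with hR₀def
  have hN₀ : ∀ n : ℕ, N₀ ≤ n → 0 < f.eval (n : ℤ) := by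
    intro n hn
    rw [Literature.NumberTheory.Sieve.eval_eq_of_natDegree_eq_two hf]
    apply quadratic_pos hA
    have h1 : ((N₀ : ℕ) : ℤ) ≤ n := by exact_mod_cast hn
    have h2 : ((N₀ : ℕ) : ℤ) = |B| + |C| + 1 := by simp [hN₀def]
    linarith
  have hBh1 : 1 ≤ Bh := by
    have : 0 < A.natAbs := Int.natAbs_pos.mpr hA.ne'
    omega
  have hBh : ∀ n x : ℕ, 1 ≤ n → n ≤ x → f.eval (n : ℤ) ≤ (Bh : ℤ) * (x : ℤ) ^ 2 := by
    intro n x h1 h2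
    rw [Literature.NumberTheory.Sieve.eval_eq_of_natDegree_eq_two hf]
    have h := quadratic_le hA (B := B) (C := C) (n := (n : ℤ)) (x := (x : ℤ))
      (by exact_mod_cast h1) (by exact_mod_cast h2)
    have e : ((Bh : ℕ) : ℤ) = A + |B| + |C| := by
      simp [hBhdef, abs_of_pos hA]
    rw [e]
    exact h
  have hgood : ∀ R : ℕ, R₀ ≤ R → ∀ p : ℕ, p.Prime → R < p →
      ¬ (p : ℤ) ∣ 2 * A * (B ^ 2 - 4 * A * C) := by
    intro R hR p hp hRp hdvd
    have hne : 2 * A * (B ^ 2 - 4 * A * C) ≠ 0 := mul_ne_zero (mul_ne_zero two_ne_zero hA.ne') hD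
    have hle : p ≤ (2 * A * (B ^ 2 - 4 * A * C)).natAbs := by
      have h1 : (p : ℤ).natAbs ∣ (2 * A * (B ^ 2 - 4 * A * C)).natAbs :=
        Int.natAbs_dvd_natAbs.mpr hdvd
      rw [Int.natAbs_natCast] at h1
      exact Nat.le_of_dvd (Int.natAbs_pos.mpr hne) h1
    omega
  -- `π(B·x) = o(x)` and the constant are `o(x)`
  have htend : Tendsto (fun x : ℕ => Bh * x) atTop atTop :=
    Filter.tendsto_atTop_mono (fun x => Nat.le_mul_of_pos_left x hBh1) tendsto_id
  have hπ : (fun x : ℕ => ((Nat.primesLE (Bh * x)).card : ℝ)) =o[atTop] (fun x : ℕ => (x : ℝ)) := by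
    have h1 := isLittleO_card_primesLE.comp_tendsto htend
    have h2 : ((fun N : ℕ => (N : ℝ)) ∘ (fun x : ℕ => Bh * x)) =O[atTop] (fun x : ℕ => (x : ℝ)) := by
      refine Asymptotics.IsBigO.of_bound (Bh : ℝ) (Eventually.of_forall (fun x => ?_))
      simp only [Function.comp_apply, Nat.cast_mul, norm_mul, Real.norm_natCast, le_refl]
    exact h1.trans_isBigO h2
  have hconst : (fun _ : ℕ => (2 * N₀ : ℝ)) =o[atTop] (fun x : ℕ => (x : ℝ)) := by
    refine Asymptotics.isLittleO_const_left.mpr (Or.inr ?_)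
    refine (tendsto_natCast_atTop_atTop (R := ℝ)).congr (fun x => ?_)
    simp only [Function.comp_apply, Real.norm_natCast]
  -- the approximation scheme `R → ∞`
  refine isLittleO_of_forall_approx R₀
    (fun R x => |∑ c ∈ (Finset.range (q * Nat.factorial R ^ 2)).filter (fun c : ℕ => c ≡ a [MOD q] ∧
            ∀ p ∈ Finset.range (R + 1), p.Prime → ¬ ((p : ℤ) ^ 2 ∣ f.eval (c : ℤ))),
          ∑ n ∈ (Finset.Icc 1 x).filter (fun n : ℕ => n ≡ c [MOD q * Nat.factorial R ^ 2]),
            (-1 : ℝ) ^ ArithmeticFunction.cardDistinctFactors ((f.eval (n : ℤ)).toNat)|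
        + (2 * N₀ + 2 * ((Nat.primesLE (Bh * x)).card : ℝ))) ?_ ?_
  · -- each `G_R` is `o(x)`: finitely many hypothesis sums, a constant, and `2π(Bx)`
    intro R hR
    have hMpos : 0 < q * Nat.factorial R ^ 2 := Nat.mul_pos hq (pow_pos (Nat.factorial_pos R) 2)
    have hF : (fun x : ℕ => ∑ c ∈ (Finset.range (q * Nat.factorial R ^ 2)).filter
          (fun c : ℕ => c ≡ a [MOD q] ∧
            ∀ p ∈ Finset.range (R + 1), p.Prime → ¬ ((p : ℤ) ^ 2 ∣ f.eval (c : ℤ))),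
          ∑ n ∈ (Finset.Icc 1 x).filter (fun n : ℕ => n ≡ c [MOD q * Nat.factorial R ^ 2]),
            (-1 : ℝ) ^ ArithmeticFunction.cardDistinctFactors ((f.eval (n : ℤ)).toNat))
        =o[atTop] (fun x : ℕ => (x : ℝ)) :=
      IsLittleO.sum (fun c _ => H f hirr hf hlc (q * Nat.factorial R ^ 2) c hMpos)
    exact (isLittleO_abs_left.mpr hF).add (hconst.add (hπ.const_mul_left 2))
  · -- the core estimate
    intro R hR hRpos x
    have hcore := core_estimate f hf N₀ hN₀ Bh hBh1 hBh R hRpos (hgood R hR) q a hq x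
    have habs := abs_sub_abs_le_abs_sub
      (∑ n ∈ (Finset.Icc 1 x).filter (fun n : ℕ => n ≡ a [MOD q]),
          (ArithmeticFunction.moebius ((f.eval (n : ℤ)).toNat) : ℝ))
      (∑ c ∈ (Finset.range (q * Nat.factorial R ^ 2)).filter (fun c : ℕ => c ≡ a [MOD q] ∧
            ∀ p ∈ Finset.range (R + 1), p.Prime → ¬ ((p : ℤ) ^ 2 ∣ f.eval (c : ℤ))),
          ∑ n ∈ (Finset.Icc 1 x).filter (fun n : ℕ => n ≡ c [MOD q * Nat.factorial R ^ 2]),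
            (-1 : ℝ) ^ ArithmeticFunction.cardDistinctFactors ((f.eval (n : ℤ)).toNat))
    have hle := le_abs_self
      (|∑ c ∈ (Finset.range (q * Nat.factorial R ^ 2)).filter (fun c : ℕ => c ≡ a [MOD q] ∧
            ∀ p ∈ Finset.range (R + 1), p.Prime → ¬ ((p : ℤ) ^ 2 ∣ f.eval (c : ℤ))),
          ∑ n ∈ (Finset.Icc 1 x).filter (fun n : ℕ => n ≡ c [MOD q * Nat.factorial R ^ 2]),
            (-1 : ℝ) ^ ArithmeticFunction.cardDistinctFactors ((f.eval (n : ℤ)).toNat)|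
        + (2 * N₀ + 2 * ((Nat.primesLE (Bh * x)).card : ℝ)))
    linarith

end Summit.Parity.BatemanHorn.Theorems
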